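import Summits.QuantumFields.BalabanUV.T4Continuum.Support.OutputRateGaussianParamBiEnd
import Summits.QuantumFields.BalabanUV.T4Continuum.Support.OutputRateTermwiseLoc

/-!
# OutputRateTermwiseLocStructural — the structural producers of the PER-DOMAIN termwise majorant `TermBoundLoc` (dominated holomorphic
# integrals, ball form, parametrised complex Gaussians, the ONE (2.14)-shape) and the structural END faces of route P1 with per-domain
# budgets, down to the most-reduced Cauchy face for (2.14)-shaped terms
# (cell `pub-balaban`, T⁴ fan-out, `HOME/BINDER-OWNERS.md` row NE5, owner lineage t4-ne5-p1, gen 30, route P1; ruling R21, part 2 of 2)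

HONEST FRAMING (T4-DAG PAGE 1).  Rung (B)+1 on ONE finite four-torus of fixed physical size — NOT infinite volume, NOT a mass gap, NOT
the Clay problem; `FlowStep.BetaPertH`, (B), (B^μ) do not occur here.  NE5 (`T4OutputRate.NE5`) is NOT PRINTED and NOT PROVED (spine
0/9, unchanged).  Nothing of Bałaban's series is asserted; 0 cite tags ([II] = [Balaban1988RG2Cluster] p. 15 (2.14), p. 20/21 (2.38)–(2.41):
the termwise majorants and their summation AT each domain `X` — printed KIND of `TermBoundLoc`/`TermBudgetLoc`, quoted in the leaf
`T4InputCauchyRateTermwise` §2).  HONEST DEPENDENCY (cell, verbatim): continuum YM on T⁴ ⇐ BetaPertH ∧ nine spine estimates (0/9 proved);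
BetaPertH ⇐ (D1) ∧ (D4) ∧ CAP+tail; G-an2-4 gates asym, D1 and NE2/3/4.

WHAT THIS MODULE IS (sequel of `OutputRateTermwiseLoc`, which has the shapes `TermBoundLoc`/`TermBudgetLoc`, the per-domain class bound and
M-test, the fibre envelopes and the END faces `…termwiseLoc_{split,slack,expLinear,expLinear_budget}_scale_nat`; every END face below
concludes `T4OutputRate.NE5` LITERALLY with the SAME smallness `ω + G·c/(1 − ρ₀) < θ′` and the SAME constant as its X-blind twin):
* §4 producers `termBoundLoc_of_opHolomorphic_majorant` (twin of `OutputRateOpHolomorphic.termBound_of_opHolomorphic_majorant`),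
  `termBoundLoc_of_ball_majorant`, `termBoundLoc_of_gaussianParam` (per-domain mass budget `paramMass … k i h X ≤ a k i X·e^{−κd(X)}`),
  `termBoundLoc_of_bi`; END faces `ne5_at_of_stepModel_termwiseLoc_biStructural_budget_scale_nat`,
  `…termwiseLoc_gaussianParam_budget_scale_nat`, `…termwiseLoc_gaussianParamBi_budget_scale_nat`,
  **`…termwiseLoc_gaussianParamBi_mass_scale_nat`** (`hball`, `hexp`, `hbd` PRODUCED from `TermGaussianParamBi` + the per-domain mass
  budget; displayed MI-R, base budget, `TermRep`, `TermBudgetLoc`, levels, W1, W4, insertion structure, W3, R, S, the letters of the shape).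
* consistency (not re-declared — the gate's dedup lint forbids restating a landed face): with constant-in-`X` weights `a k i`, §4's mass
  face applied to `termBudgetLoc_of_termBudget hbud` IS the gen-29 X-blind face `OutputRateGaussianParamBiEnd.ne5_at_of_stepModel_termwise_
  gaussianParamBi_mass_scale_nat` token for token (checked on the farm before filing; the bridges are in `OutputRateTermwiseLoc` §1).

STATUS (census, Edison rule).  Bookkeeping/[folklore]; discharges NO wall; NE5 NOT PROVED; 0/12 leaves on Bałaban's concrete objects; spine
0/9; rung (B)+1 finite T⁴; NOT infinite volume / mass gap / Clay.  0 sorry; axioms ⊆ {propext, Classical.choice, Quot.sound}.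
-/

noncomputable section

open Set Metric MeasureTheory Filter

namespace Summit.QuantumFields.BalabanUV.T4Continuum.OutputRateTermwiseLocStructural

open Literature.MathematicalPhysics.QuantumFieldTheory.Balaban1983to89
open Literature.MathematicalPhysics.QuantumFieldTheory.Balaban1983to89.T4OutputRate
open Literature.MathematicalPhysics.QuantumFieldTheory.Balaban1983to89.T4InputCauchyRate
open Literature.MathematicalPhysics.QuantumFieldTheory.Balaban1983to89.T4InputCauchyRateData
open Literature.MathematicalPhysics.QuantumFieldTheory.Balaban1983to89.T4InputCauchyRateSpecies
open Literature.MathematicalPhysics.QuantumFieldTheory.Balaban1983to89.T4InputCauchyRateTermwise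
open Summit.QuantumFields.BalabanUV.T4Continuum.OutputRateOpHolomorphic
open Summit.QuantumFields.BalabanUV.T4Continuum.OutputRateOpGaussian
open Summit.QuantumFields.BalabanUV.T4Continuum.OutputRateOpGaussianParam
open Summit.QuantumFields.BalabanUV.T4Continuum.OutputRateGaussianParamBi
open Summit.QuantumFields.BalabanUV.T4Continuum.OutputRateGaussianParamBiEnd
open Summit.QuantumFields.BalabanUV.T4Continuum.OutputRateTermwiseLoc

/-! ## §4 Structural producers of `TermBoundLoc` (dominated holomorphic integrals, ball form, parametrised Gaussians, the ONE shape)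
## and the structural END faces with per-domain budgets -/

section Structural

variable {C : Carriers} {Op Hist : Type*} [NormedAddCommGroup Op] [NormedSpace ℂ Op] [NormedAddCommGroup Hist]
  [NormedSpace ℂ Hist] {ι : Type*} {K : ℕ → (ℕ → ℝ) → C.BgB → Set (Op × Hist)} {T : ℕ → ι → Op → Hist → C.Dom → ℂ}

omit [NormedAddCommGroup Hist] [NormedSpace ℂ Hist] in
/-- **DOMINATED HOLOMORPHIC INTEGRALS WITH A PER-DOMAIN BUDGETED MAJORANT GIVE `TermBoundLoc`** —
`OutputRateOpHolomorphic.termBound_of_opHolomorphic_majorant` with the majorant's mass `≤ a k i X·e^{−κd(X)}`. [folklore] -/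
theorem termBoundLoc_of_opHolomorphic_majorant {W : Set (ℕ → ℝ)} {α : ℕ → ι → Type*} [∀ k i, MeasurableSpace (α k i)]
    {μ : ∀ k i, Hist → C.Dom → Measure (α k i)} {f : ∀ k i, Hist → C.Dom → Op → α k i → ℂ}
    {𝒪 : ℕ → (ℕ → ℝ) → C.BgB → Hist → Set Op} (hhol : TermOpHolomorphic K T W μ f 𝒪) {κ : ℝ} {a : ℕ → ι → C.Dom → ℝ}
    (hmaj : ∀ k, ∀ g ∈ W, ∀ (U : C.BgB) (q : Op × Hist), q ∈ K k g U → ∀ X : C.Dom, C.scale X = k → ∀ i,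
      ∃ bd : α k i → ℝ, Integrable bd (μ k i q.2 X) ∧ (∀ᵐ z ∂(μ k i q.2 X), ‖f k i q.2 X q.1 z‖ ≤ bd z) ∧
        ∫ z, bd z ∂(μ k i q.2 X) ≤ a k i X * Real.exp (-(κ * C.d X))) :
    TermBoundLoc K T W κ a := by
  intro k g hg U q hq X hX i
  obtain ⟨hKO, hX'⟩ := hhol k g hg U q.2 ⟨q.1, hq⟩
  obtain ⟨-, -, -, hrepr⟩ := hX' X hX i
  obtain ⟨bd, hbdi, hle, hbud⟩ := hmaj k g hg U q hq X hX i
  rw [hrepr q.1 (hKO q.1 hq)]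
  exact (norm_integral_le_of_majorant hbdi hle).trans hbud

omit [NormedSpace ℂ Hist] in
/-- **BALL FORM WITH A PER-DOMAIN BUDGETED MAJORANT ⟹ `TermBoundLoc` ON THE BALL CLASS** —
`OutputRateOpHolomorphic.termBound_of_ball_majorant` with mass `≤ a k i X·e^{−κd(X)}`. [folklore] -/
theorem termBoundLoc_of_ball_majorant {W : Set (ℕ → ℝ)} {ctr : ℕ → (ℕ → ℝ) → C.BgB → Op × Hist} {ROp RHist R' : ℕ → ℝ}
    {α : ℕ → ι → Type*} [∀ k i, MeasurableSpace (α k i)] {μ : ∀ k i, Hist → C.Dom → Measure (α k i)}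
    {f : ∀ k i, Hist → C.Dom → Op → α k i → ℂ} (hroom : ∀ k, ROp k < R' k)
    (hball : TermOpHolomorphicBall T W ctr RHist R' μ f) {κ : ℝ} {a : ℕ → ι → C.Dom → ℝ}
    (hmass : ∀ k, ∀ g ∈ W, ∀ (U : C.BgB), ∀ h ∈ closedBall (ctr k g U).2 (RHist k), ∀ X : C.Dom, C.scale X = k → ∀ i,
      ∃ bd : α k i → ℝ, Integrable bd (μ k i h X) ∧
        (∀ᵐ z ∂(μ k i h X), ∀ o ∈ ball (ctr k g U).1 (R' k), ‖f k i h X o z‖ ≤ bd z) ∧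
          ∫ z, bd z ∂(μ k i h X) ≤ a k i X * Real.exp (-(κ * C.d X))) :
    TermBoundLoc (ballClass ctr ROp RHist) T W κ a := by
  refine termBoundLoc_of_opHolomorphic_majorant (termOpHolomorphic_of_ball hroom hball) fun k g hg U q hq X hX i => ?_
  have hq' := Set.mem_prod.1 hq
  have ho : q.1 ∈ ball (ctr k g U).1 (R' k) := mem_ball.2 (lt_of_le_of_lt (mem_closedBall.1 hq'.1) (hroom k))
  obtain ⟨bd, hbdi, hble, hbud⟩ := hmass k g hg U q.2 hq'.2 X hX i
  exact ⟨bd, hbdi, by filter_upwards [hble] with z hz using hz q.1 ho, hbud⟩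

variable {β : ℕ → ι → Type*} [∀ k i, MeasurableSpace (β k i)]
  {α : ℕ → ι → Type*} [∀ k i, NormedAddCommGroup (α k i)] [∀ k i, InnerProductSpace ℝ (α k i)]
  [∀ k i, FiniteDimensional ℝ (α k i)] [∀ k i, MeasurableSpace (α k i)] [∀ k i, BorelSpace (α k i)]

omit [NormedSpace ℂ Hist] in
/-- **`TermBoundLoc` ON THE BALL CLASS FROM A PARAMETRISED GAUSSIAN FAMILY AND THE PER-DOMAIN MASS BUDGET**
`paramMass α lam m b w₀ N₀ G₀ k i h X ≤ a k i X·e^{−κd(X)}` (`OutputRateOpGaussianParam.termBound_of_gaussianParam`, per domain). [folklore] -/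
theorem termBoundLoc_of_gaussianParam {W : Set (ℕ → ℝ)} {ctr : ℕ → (ℕ → ℝ) → C.BgB → Op × Hist} {ROp RHist R' : ℕ → ℝ}
    {lam : ∀ k i, Hist → C.Dom → Measure (β k i)} {w : ∀ k i, Hist → C.Dom → β k i → ℂ}
    {N : ∀ k i, Hist → C.Dom → Op → β k i → ℂ} {gIns : ∀ k i, Hist → C.Dom → β k i → α k i → ℂ}
    {q : ∀ k i, Hist → C.Dom → Op → β k i → α k i → ℂ} {m b w₀ N₀ G₀ : ℕ → ι → Hist → C.Dom → ℝ}
    (hroom : ∀ k, ROp k < R' k) (hG : TermOpGaussianParam T W ctr RHist R' lam w N gIns q m b w₀ N₀ G₀) {κ : ℝ}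
    {a : ℕ → ι → C.Dom → ℝ}
    (hbudget : ∀ k, ∀ g ∈ W, ∀ (U : C.BgB), ∀ h ∈ closedBall (ctr k g U).2 (RHist k), ∀ X : C.Dom, C.scale X = k → ∀ i,
      paramMass α lam m b w₀ N₀ G₀ k i h X ≤ a k i X * Real.exp (-(κ * C.d X))) :
    TermBoundLoc (ballClass ctr ROp RHist) T W κ a := by
  refine termBoundLoc_of_ball_majorant hroom (termOpHolomorphicBall_of_gaussianParam hG) fun k g hg U h hh X hX i => ?_
  obtain ⟨hfin, hm, hwm, hwb, hNm, hNh, hNb, hgm, hgb, hqm, hqh, hqre, -⟩ := hG k g hg U h hh X hX i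
  haveI := hfin
  obtain ⟨-, -, hint, hdom⟩ := paramGaussianTerm_clauses hm hwm hwb hNm hNh hNb hgm hgb hqm hqh hqre
  refine ⟨_, hint, hdom, ?_⟩
  rw [integral_paramMajorant (lam k i h X) hm]
  exact hbudget k g hg U h hh X hX i

/-- **`TermBoundLoc` FROM THE ONE (2.14)-SHAPE + THE PER-DOMAIN MASS BUDGET** (`OutputRateGaussianParamBiEnd.termBound_of_bi`, per domain):
`TermGaussianParamBi` with room `ROp k < R′ k` and `paramMass α lam m b w₀ N₀ (F·e^{N₁‖h‖}) k i h X ≤ a k i X·e^{−κd(X)}`. [folklore] -/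
theorem termBoundLoc_of_bi {W : Set (ℕ → ℝ)} {ctr : ℕ → (ℕ → ℝ) → C.BgB → Op × Hist} {ROp RHist R' : ℕ → ℝ}
    {lam : ∀ k i, C.Dom → Measure (β k i)} {w : ∀ k i, C.Dom → β k i → ℂ} {N : ∀ k i, C.Dom → Op → β k i → ℂ}
    {F₀ : ∀ k i, C.Dom → β k i → α k i → ℂ} {Λ : ∀ k i, C.Dom → β k i → α k i → (Hist →L[ℂ] ℂ)}
    {q : ∀ k i, C.Dom → Op → β k i → α k i → ℂ} {m b w₀ N₀ F N₁ : ℕ → ι → C.Dom → ℝ} (hroom : ∀ k, ROp k < R' k)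
    (hBi : TermGaussianParamBi T W ctr RHist R' lam w N F₀ Λ q m b w₀ N₀ F N₁) {κ : ℝ} {a : ℕ → ι → C.Dom → ℝ}
    (hmass : ∀ k, ∀ g ∈ W, ∀ (U : C.BgB), ∀ h ∈ closedBall (ctr k g U).2 (RHist k), ∀ X : C.Dom, C.scale X = k → ∀ i,
      paramMass α (fun k i (_ : Hist) X => lam k i X) (fun k i (_ : Hist) X => m k i X) (fun k i (_ : Hist) X => b k i X)
        (fun k i (_ : Hist) X => w₀ k i X) (fun k i (_ : Hist) X => N₀ k i X)
        (fun k i h X => F k i X * Real.exp (N₁ k i X * ‖h‖)) k i h X ≤ a k i X * Real.exp (-(κ * C.d X))) :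
    TermBoundLoc (ballClass ctr ROp RHist) T W κ a :=
  termBoundLoc_of_gaussianParam hroom (termOpGaussianParam_of_bi hBi) hmass

end Structural

section StructuralEnd

variable {C : Carriers} {Op Hist : Type*} [NormedAddCommGroup Op] [NormedSpace ℂ Op] [NormedAddCommGroup Hist]
  [NormedSpace ℂ Hist] {ι : Type*} (M : StepModel C Op Hist) (T : ℕ → ι → Op → Hist → C.Dom → ℂ)
  {β : ℕ → ι → Type*} [∀ k i, MeasurableSpace (β k i)]
  {α : ℕ → ι → Type*} [∀ k i, NormedAddCommGroup (α k i)] [∀ k i, InnerProductSpace ℝ (α k i)]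
  [∀ k i, FiniteDimensional ℝ (α k i)] [∀ k i, MeasurableSpace (α k i)] [∀ k i, BorelSpace (α k i)]

/-- **NE5 FROM BUDGET, TERMWISE DATA WITH PER-DOMAIN BUDGETS AND BOTH SPECIES STRUCTURAL ON THE UNDILATED BALL CLASS** —
`OutputRateOpHolomorphic.ne5_at_of_stepModel_termwise_biStructural_budget_scale_nat` with per-domain weights (`hball` = the ball form,
`hexp` = exp-linear history terms); SAME smallness, SAME constant; conclusion `T4OutputRate.NE5` LITERALLY. [folklore] -/
theorem ne5_at_of_stepModel_termwiseLoc_biStructural_budget_scale_nat {EA : Functional C C.BgA} {EB : Functional C C.BgB}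
    {W : Set (ℕ → ℝ)} {ctr : ℕ → (ℕ → ℝ) → C.BgB → Op × Hist} {BOp BHist ROp RHist R' : ℕ → ℝ} {a : ℕ → ι → C.Dom → ℝ}
    {αO : ℕ → ι → Type*} [∀ k i, MeasurableSpace (αO k i)] {μO : ∀ k i, Hist → C.Dom → Measure (αO k i)}
    {f : ∀ k i, Hist → C.Dom → Op → αO k i → ℂ} {αH : ℕ → ι → Type*} [∀ k i, MeasurableSpace (αH k i)]
    {μ : ∀ k i, Op → C.Dom → Measure (αH k i)} {Φ : ∀ k i, Op → C.Dom → αH k i → ℂ}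
    {Λ : ∀ k i, Op → C.Dom → αH k i → (Hist →L[ℂ] ℂ)} {κ G EA₀ E₀ E₁ δ δ' θ θ' c ω ρ₀ B : ℝ} {k₀ : ℕ}
    (hrA : M.RepresentsA EA W) (hrB : M.RepresentsB EB W) (hbase : M.InBase EB W) (hbudget : BaseBudget M W ctr BOp BHist)
    (hOp : ∀ k, BOp k + M.rOp k ≤ ROp k) (hHist : ∀ k, BHist k + M.rHist k ≤ RHist k)
    (hrep : TermRep M (ballClass ctr ROp RHist) T W) (hbd : TermBoundLoc (ballClass ctr ROp RHist) T W κ a)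
    (hbud : TermBudgetLoc a G) (hroom : ∀ k, ROp k < R' k) (hball : TermOpHolomorphicBall T W ctr RHist R' μO f)
    (hexp : TermHistExpLinear (ballClass ctr ROp RHist) T W μ Φ Λ) (hdA : DecayBound EA W EA₀ κ)
    (hdB : DecayBound EB W E₀ κ) (hop : M.OperatorRate W δ θ) (hins : M.InsertionRate W κ E₀ δ' θ)
    (haff : M.InsAffine W) (hblind : M.InsBlind W) (hhom : M.InsHomog W) (hunit : M.InsScaleBound W κ E₁ c ω)
    (hE₁ : 0 < E₁) (hG : 0 ≤ G) (hδ : 0 ≤ δ) (hδ' : 0 ≤ δ') (hθ : 0 ≤ θ) (hθθ' : θ ≤ θ') (hθ'1 : θ' ≤ 1) (hc : 0 ≤ c)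
    (hω : 0 < ω) (hρ₀ : ρ₀ < 1) (hnear : (δ + δ') * θ ^ k₀ + c * (EA₀ + E₀) / (1 - ω) ≤ ρ₀) (hB : 0 ≤ B)
    (hfirst : ∀ k < k₀, EA₀ + E₀ ≤ B * θ ^ k) (hsmall : ω + G / (1 - ρ₀) * c < θ') :
    NE5 EA EB W κ θ' ((G / (1 - ρ₀) * δ + G / (1 - ρ₀) * δ' + B) * (θ' - ω) / (θ' - (ω + G / (1 - ρ₀) * c))) :=
  ne5_at_of_stepModel_termwiseLoc_expLinear_budget_scale_nat M T hrA hrB hbase hbudget hOp hHist hrep hbd hbud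
    (termOpLineAnalytic_of_ball hroom hball) hexp hdA hdB hop hins haff hblind hhom hunit hE₁ hG hδ hδ' hθ hθθ' hθ'1 hc hω
    hρ₀ hnear hB hfirst hsmall

/-- **NE5 FROM BUDGET, TERMWISE DATA WITH PER-DOMAIN BUDGETS, THE OPERATOR SPECIES A PARAMETRISED GAUSSIAN FAMILY AND THE HISTORY SPECIES
EXP-LINEAR** — `OutputRateOpGaussianParam.ne5_at_of_stepModel_termwise_gaussianParam_budget_scale_nat` with per-domain weights; SAME
smallness, SAME constant; conclusion `T4OutputRate.NE5` LITERALLY. [folklore] -/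
theorem ne5_at_of_stepModel_termwiseLoc_gaussianParam_budget_scale_nat {EA : Functional C C.BgA} {EB : Functional C C.BgB}
    {W : Set (ℕ → ℝ)} {ctr : ℕ → (ℕ → ℝ) → C.BgB → Op × Hist} {BOp BHist ROp RHist R' : ℕ → ℝ} {a : ℕ → ι → C.Dom → ℝ}
    {lam : ∀ k i, Hist → C.Dom → Measure (β k i)} {w : ∀ k i, Hist → C.Dom → β k i → ℂ}
    {N : ∀ k i, Hist → C.Dom → Op → β k i → ℂ} {gIns : ∀ k i, Hist → C.Dom → β k i → α k i → ℂ}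
    {q : ∀ k i, Hist → C.Dom → Op → β k i → α k i → ℂ} {m b w₀ N₀ G₀ : ℕ → ι → Hist → C.Dom → ℝ}
    {αH : ℕ → ι → Type*} [∀ k i, MeasurableSpace (αH k i)]
    {μ : ∀ k i, Op → C.Dom → Measure (αH k i)} {Φ : ∀ k i, Op → C.Dom → αH k i → ℂ}
    {Λ : ∀ k i, Op → C.Dom → αH k i → (Hist →L[ℂ] ℂ)} {κ G EA₀ E₀ E₁ δ δ' θ θ' c ω ρ₀ B : ℝ} {k₀ : ℕ}
    (hrA : M.RepresentsA EA W) (hrB : M.RepresentsB EB W) (hbase : M.InBase EB W) (hbudget : BaseBudget M W ctr BOp BHist)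
    (hOp : ∀ k, BOp k + M.rOp k ≤ ROp k) (hHist : ∀ k, BHist k + M.rHist k ≤ RHist k)
    (hrep : TermRep M (ballClass ctr ROp RHist) T W) (hbd : TermBoundLoc (ballClass ctr ROp RHist) T W κ a)
    (hbud : TermBudgetLoc a G) (hroom : ∀ k, ROp k < R' k)
    (hG : TermOpGaussianParam T W ctr RHist R' lam w N gIns q m b w₀ N₀ G₀)
    (hexp : TermHistExpLinear (ballClass ctr ROp RHist) T W μ Φ Λ) (hdA : DecayBound EA W EA₀ κ)
    (hdB : DecayBound EB W E₀ κ) (hop : M.OperatorRate W δ θ) (hins : M.InsertionRate W κ E₀ δ' θ)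
    (haff : M.InsAffine W) (hblind : M.InsBlind W) (hhom : M.InsHomog W) (hunit : M.InsScaleBound W κ E₁ c ω)
    (hE₁ : 0 < E₁) (hG0 : 0 ≤ G) (hδ : 0 ≤ δ) (hδ' : 0 ≤ δ') (hθ : 0 ≤ θ) (hθθ' : θ ≤ θ') (hθ'1 : θ' ≤ 1) (hc : 0 ≤ c)
    (hω : 0 < ω) (hρ₀ : ρ₀ < 1) (hnear : (δ + δ') * θ ^ k₀ + c * (EA₀ + E₀) / (1 - ω) ≤ ρ₀) (hB : 0 ≤ B)
    (hfirst : ∀ k < k₀, EA₀ + E₀ ≤ B * θ ^ k) (hsmall : ω + G / (1 - ρ₀) * c < θ') :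
    NE5 EA EB W κ θ' ((G / (1 - ρ₀) * δ + G / (1 - ρ₀) * δ' + B) * (θ' - ω) / (θ' - (ω + G / (1 - ρ₀) * c))) :=
  ne5_at_of_stepModel_termwiseLoc_biStructural_budget_scale_nat M T hrA hrB hbase hbudget hOp hHist hrep hbd hbud hroom
    (termOpHolomorphicBall_of_gaussianParam hG) hexp hdA hdB hop hins haff hblind hhom hunit hE₁ hG0 hδ hδ' hθ hθθ' hθ'1 hc
    hω hρ₀ hnear hB hfirst hsmall

/-- **NE5 FROM BUDGET, TERMWISE DATA WITH PER-DOMAIN BUDGETS AND THE ONE (2.14)-SHAPE FOR BOTH SPECIES** —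
`OutputRateGaussianParamBi.ne5_at_of_stepModel_termwise_gaussianParamBi_budget_scale_nat` with per-domain weights (`hball`, `hexp` PRODUCED
from `TermGaussianParamBi`, room `ROp k < R′ k`); SAME smallness, SAME constant; conclusion `T4OutputRate.NE5` LITERALLY. [folklore] -/
theorem ne5_at_of_stepModel_termwiseLoc_gaussianParamBi_budget_scale_nat {EA : Functional C C.BgA} {EB : Functional C C.BgB}
    {W : Set (ℕ → ℝ)} {ctr : ℕ → (ℕ → ℝ) → C.BgB → Op × Hist} {BOp BHist ROp RHist R' : ℕ → ℝ} {a : ℕ → ι → C.Dom → ℝ}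
    {lam : ∀ k i, C.Dom → Measure (β k i)} {w : ∀ k i, C.Dom → β k i → ℂ} {N : ∀ k i, C.Dom → Op → β k i → ℂ}
    {F₀ : ∀ k i, C.Dom → β k i → α k i → ℂ} {Λ : ∀ k i, C.Dom → β k i → α k i → (Hist →L[ℂ] ℂ)}
    {q : ∀ k i, C.Dom → Op → β k i → α k i → ℂ} {m b w₀ N₀ F N₁ : ℕ → ι → C.Dom → ℝ}
    {κ G EA₀ E₀ E₁ δ δ' θ θ' c ω ρ₀ B : ℝ} {k₀ : ℕ}
    (hrA : M.RepresentsA EA W) (hrB : M.RepresentsB EB W) (hbase : M.InBase EB W) (hbudget : BaseBudget M W ctr BOp BHist)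
    (hOp : ∀ k, BOp k + M.rOp k ≤ ROp k) (hHist : ∀ k, BHist k + M.rHist k ≤ RHist k)
    (hrep : TermRep M (ballClass ctr ROp RHist) T W) (hbd : TermBoundLoc (ballClass ctr ROp RHist) T W κ a)
    (hbud : TermBudgetLoc a G) (hroom : ∀ k, ROp k < R' k)
    (hBi : TermGaussianParamBi T W ctr RHist R' lam w N F₀ Λ q m b w₀ N₀ F N₁)
    (hdA : DecayBound EA W EA₀ κ) (hdB : DecayBound EB W E₀ κ) (hop : M.OperatorRate W δ θ)
    (hins : M.InsertionRate W κ E₀ δ' θ) (haff : M.InsAffine W) (hblind : M.InsBlind W) (hhom : M.InsHomog W)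
    (hunit : M.InsScaleBound W κ E₁ c ω) (hE₁ : 0 < E₁) (hG0 : 0 ≤ G) (hδ : 0 ≤ δ) (hδ' : 0 ≤ δ') (hθ : 0 ≤ θ)
    (hθθ' : θ ≤ θ') (hθ'1 : θ' ≤ 1) (hc : 0 ≤ c) (hω : 0 < ω) (hρ₀ : ρ₀ < 1)
    (hnear : (δ + δ') * θ ^ k₀ + c * (EA₀ + E₀) / (1 - ω) ≤ ρ₀) (hB : 0 ≤ B) (hfirst : ∀ k < k₀, EA₀ + E₀ ≤ B * θ ^ k)
    (hsmall : ω + G / (1 - ρ₀) * c < θ') :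
    NE5 EA EB W κ θ' ((G / (1 - ρ₀) * δ + G / (1 - ρ₀) * δ' + B) * (θ' - ω) / (θ' - (ω + G / (1 - ρ₀) * c))) :=
  ne5_at_of_stepModel_termwiseLoc_biStructural_budget_scale_nat M T hrA hrB hbase hbudget hOp hHist hrep hbd hbud hroom
    (termOpHolomorphicBall_of_gaussianParam (termOpGaussianParam_of_bi hBi)) (termHistExpLinear_of_bi hroom hBi) hdA hdB
    hop hins haff hblind hhom hunit hE₁ hG0 hδ hδ' hθ hθθ' hθ'1 hc hω hρ₀ hnear hB hfirst hsmall

/-- **NE5 FROM THE ONE (2.14)-SHAPE WITH THE PER-DOMAIN TERMWISE MAJORANT ALSO PRODUCED** — the most-reduced Cauchy face for (2.14)-shaped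
terms (`OutputRateGaussianParamBiEnd.ne5_at_of_stepModel_termwise_gaussianParamBi_mass_scale_nat`) with PER-DOMAIN weights: `hbd` REPLACED by
the per-domain mass budget `hmass : paramMass … k i h X ≤ a k i X·e^{−κd(X)}`, `hbud : TermBudgetLoc a G`; every other binder BY NAME; SAME
smallness `ω + G·c/(1 − ρ₀) < θ′`, SAME constant; conclusion `T4OutputRate.NE5` LITERALLY.  Displayed after this face: MI-R, base budget,
`TermRep`, `TermBudgetLoc` (the (2.38)–(2.41) combinatorics AT each domain), levels, W1, W4, insertion structure, W3, R, S, the letters of the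
ONE shape.  NOT a proof of NE5 for Bałaban's step: no binder is instantiated on his objects here. [folklore] -/
theorem ne5_at_of_stepModel_termwiseLoc_gaussianParamBi_mass_scale_nat {EA : Functional C C.BgA} {EB : Functional C C.BgB}
    {W : Set (ℕ → ℝ)} {ctr : ℕ → (ℕ → ℝ) → C.BgB → Op × Hist} {BOp BHist ROp RHist R' : ℕ → ℝ} {a : ℕ → ι → C.Dom → ℝ}
    {lam : ∀ k i, C.Dom → Measure (β k i)} {w : ∀ k i, C.Dom → β k i → ℂ} {N : ∀ k i, C.Dom → Op → β k i → ℂ}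
    {F₀ : ∀ k i, C.Dom → β k i → α k i → ℂ} {Λ : ∀ k i, C.Dom → β k i → α k i → (Hist →L[ℂ] ℂ)}
    {q : ∀ k i, C.Dom → Op → β k i → α k i → ℂ} {m b w₀ N₀ F N₁ : ℕ → ι → C.Dom → ℝ}
    {κ G EA₀ E₀ E₁ δ δ' θ θ' c ω ρ₀ B : ℝ} {k₀ : ℕ}
    (hrA : M.RepresentsA EA W) (hrB : M.RepresentsB EB W) (hbase : M.InBase EB W) (hbudget : BaseBudget M W ctr BOp BHist)
    (hOp : ∀ k, BOp k + M.rOp k ≤ ROp k) (hHist : ∀ k, BHist k + M.rHist k ≤ RHist k)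
    (hrep : TermRep M (ballClass ctr ROp RHist) T W) (hbud : TermBudgetLoc a G) (hroom : ∀ k, ROp k < R' k)
    (hBi : TermGaussianParamBi T W ctr RHist R' lam w N F₀ Λ q m b w₀ N₀ F N₁)
    (hmass : ∀ k, ∀ g ∈ W, ∀ (U : C.BgB), ∀ h ∈ closedBall (ctr k g U).2 (RHist k), ∀ X : C.Dom, C.scale X = k → ∀ i,
      paramMass α (fun k i (_ : Hist) X => lam k i X) (fun k i (_ : Hist) X => m k i X) (fun k i (_ : Hist) X => b k i X)
        (fun k i (_ : Hist) X => w₀ k i X) (fun k i (_ : Hist) X => N₀ k i X)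
        (fun k i h X => F k i X * Real.exp (N₁ k i X * ‖h‖)) k i h X ≤ a k i X * Real.exp (-(κ * C.d X)))
    (hdA : DecayBound EA W EA₀ κ) (hdB : DecayBound EB W E₀ κ) (hop : M.OperatorRate W δ θ)
    (hins : M.InsertionRate W κ E₀ δ' θ) (haff : M.InsAffine W) (hblind : M.InsBlind W) (hhom : M.InsHomog W)
    (hunit : M.InsScaleBound W κ E₁ c ω) (hE₁ : 0 < E₁) (hG0 : 0 ≤ G) (hδ : 0 ≤ δ) (hδ' : 0 ≤ δ') (hθ : 0 ≤ θ)
    (hθθ' : θ ≤ θ') (hθ'1 : θ' ≤ 1) (hc : 0 ≤ c) (hω : 0 < ω) (hρ₀ : ρ₀ < 1)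
    (hnear : (δ + δ') * θ ^ k₀ + c * (EA₀ + E₀) / (1 - ω) ≤ ρ₀) (hB : 0 ≤ B) (hfirst : ∀ k < k₀, EA₀ + E₀ ≤ B * θ ^ k)
    (hsmall : ω + G / (1 - ρ₀) * c < θ') :
    NE5 EA EB W κ θ' ((G / (1 - ρ₀) * δ + G / (1 - ρ₀) * δ' + B) * (θ' - ω) / (θ' - (ω + G / (1 - ρ₀) * c))) :=
  ne5_at_of_stepModel_termwiseLoc_gaussianParamBi_budget_scale_nat M T hrA hrB hbase hbudget hOp hHist hrep
    (termBoundLoc_of_bi hroom hBi hmass) hbud hroom hBi hdA hdB hop hins haff hblind hhom hunit hE₁ hG0 hδ hδ' hθ hθθ' hθ'1 hc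
    hω hρ₀ hnear hB hfirst hsmall

end StructuralEnd

end Summit.QuantumFields.BalabanUV.T4Continuum.OutputRateTermwiseLocStructural

end
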